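import Summits.CriticalPhenomena.PercolationContinuityZ3.Theorems.Transplant.SkelConcFaceRouteLink
import HarnessLib

/-!
# Kozma–Nitzan Lemma 11 over a planar skeleton — the face step's ROUTE CLAUSE at a deep contact (hp-8 (F) part B, port of the
# product's `BoxProdZ2ConcFaceRoute.route_of_contact`): the `hroute` hypothesis of `SkelI.hcon_win₂'` (L5.15) for the face window

builds on p205010 (kernel theorem, internal audit signed; external expert review pending) — nothing in this file uses p205010.
Lane `prim-bschramm`, typed by the `prim-hp-8` lineage (gen 24); helper file (`--supports stmt-CriticalPhenomena-4575 --as helper`).  NEW FILE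
over `SkelConcFaceRouteLink` (`Skel.innerRoute_link_lt`), `SkelConcFaceInnerRun` (`PCells.innerRunOK_contact_shifted`), `SkelConcFaceInnerRoute`.

Setting: the face window of the cell step `x → x + du` at face index `j` (centre `w₀`, radius `R`, region `Rg = Win w₀ (farAS x du j) R`,
true target `M_{a'}(x + du)` of the geometry `cellGeomSG Φ C w₀ Λ`), a vertex `o` (the cube centre of a near contact of a level `≤ Rlev`)
with footprint in the thickened face row `Icc (faceLo − Rlev) (faceHi + Rlev)` and DEEP: `B_G(o, L_A) ⊆ B_G(w₀, R₁')`, `R₁' + 1 ≤ rM_{a'}(x+du)`,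
`R₁' ≤ R`.  With `lv = lev(φ o)`, `b = φ o (oth) − cen x (oth)`, `ca = lv + ℓ1`, `nA = ⌊(17r − ca)⁺/s₁⌋ ≤ nmax`, the inner elongated chain
`innerWAD … o L_A L'_A ca b ℓ1 s₁ R' ℓ₀ nA RlevA N_A (M+1) RlevA Sfin` is admissible (`innerRunOK_contact_shifted`), its world
`Qt = innerQt … (φ o) ℓ1` lies in `Rg`, its far core `Ft = coreT nA` lies in `M_{a'}(x+du)` and misses the cube `fatSeq o M`, and
`Skel.innerRoute_link_lt` bounds the link probability:
* `l1_le_of_ax` (ℓ¹ norm via the run axis), **`innerWAD_coreT_nonempty`** (`28 r + 2 Rlev ≤ L_A`);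
* **`hroute_face`**: `∃ Qt Ft, Ft ⊆ M_{a'}(x+du) ∧ Qt ⊆ Rg ∧ (Qt's G-edges are window-graph edges) ∧ Disjoint Ft (fatSeq o M) ∧
  1 − ε'' < P_{Wt}(linkIn Qt (fatSeq o mₛ) Ft)` — from the multi-step chain estimate for every `n ≤ nmax` (`hchain`), the inner kits under the
  route law for every admissible inner datum (`hkitsA`), the centre-uniform excess radius, the count, and the FINE first-hop link input
  `1 − δ < P_q(linkIn (fatSeq o ℓ1) (fatSeq o mₛ) (macroPiece o ℓ1 (ψ ℓ1) (faceElt du.1 τ)))`.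
[cite: KozmaNitzan2024, §4 Lemma 11 (pp. 22–23), Lemma 12 (p. 24)]
-/

noncomputable section

open MeasureTheory
open scoped Classical

namespace Summit.CriticalPhenomena.PercolationContinuityZ3.Theorems

namespace Transplant

namespace Skel

open Literature.Probability.Percolation Literature.Probability.LatticeModels SimpleGraph KNLevels KNCells ChainPlanar
open Literature.Probability.Percolation.KozmaNitzan
open Literature.Probability.Percolation.KozmaNitzan.Cells (oth oth_ne eq_oth_of_ne sgOf sgOf_sign stepVec_apply_fst stepVec_apply_oth)
open Literature.Probability.Percolation.GM (HOct)
open Literature.Barriers.CriticalPhenomena (graphBall graphBall_finite mem_graphBall_self graphBall_mono)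
open BoxProdZ2 (ConcRadiiG InnerRunOK innerCtr innerρ innerCtr_fst innerCtr_oth sg_mul_sub_add innerRun_advOK)
open PlanarSkeletonConc

variable {V : Type} [DecidableEq V] {G : SimpleGraph V} [G.LocallyFinite] (Φ : PlanarSkeletonConc G)

/-! ## §1 The far cores of the inner chain are nonempty -/

omit [DecidableEq V] [G.LocallyFinite] in
/-- The `ℓ¹` norm of a planar vector through the run axis `a` and the other axis. [folklore] -/
theorem l1_le_of_ax (a : Fin 2) (y : Site 2) {m n : ℤ} (ha : -m ≤ y a ∧ y a ≤ m) (ho : -n ≤ y (oth a) ∧ y (oth a) ≤ n) :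
    (((y 0).natAbs + (y 1).natAbs : ℕ) : ℤ) ≤ m + n := by
  rcases Fin.exists_fin_two.1 ⟨a, rfl⟩ with h | h
  · rw [h] at ha ho
    have h1 : oth (0 : Fin 2) = 1 := by decide
    rw [h1] at ho; omega
  · rw [h] at ha ho
    have h1 : oth (1 : Fin 2) = 0 := by decide
    rw [h1] at ho; omega

/-- Footprints in the thickened face row: level in `[faceL j − n, faceL j + n]`, transverse offset `≤ 2r + n`. [folklore] -/
theorem lev_of_mem_faceRow_thicken (C : PCells) (x : Site 2) (du : MDir) (j n : ℕ) {z : Site 2}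
    (hz : z ∈ Finset.Icc (C.faceLo x du j - (n : Site 2)) (C.faceHi x du j + (n : Site 2))) :
    C.faceL j - n ≤ C.lev du x z ∧ C.lev du x z ≤ C.faceL j + n ∧ |z (oth du.1) - C.cen x (oth du.1)| ≤ 2 * (C.r : ℤ) + n := by
  rw [PCells.faceLo, PCells.faceHi, sBox_enlarge _ _ (sgOf_sign du), PCells.mem_psBox_iff] at hz
  unfold PCells.lev
  refine ⟨hz.1.1, hz.1.2, abs_le.2 ⟨by linarith [hz.2.1], by linarith [hz.2.2]⟩⟩

omit [DecidableEq V] in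
/-- **The far cores `coreT k`, `k ≤ nA`, of the inner chain rooted at `o` are nonempty** once `28 r + 2 Rlev ≤ L_A`: the planar core
`core (k+1) ⊆ regionR k ⊆ farAS` is nonempty and within `ℓ¹`-distance `27 r + 2 Rlev` of `φ o`, and the skeleton's step device realises
every planar point within that graph distance (`PlanarSkeleton.exists_mem_graphBall_φ_eq`). [folklore] -/
theorem innerWAD_coreT_nonempty [Countable V] {C : PCells} {x : Site 2} {du : MDir} {o : V} {L_A L'_A : ℕ} {ca cb q' s₁ : ℤ}
    {R' ℓ₀ nA RlevA N j₀ j₁ : ℕ} {Sfin : Finset V} {j Rlev : ℕ} (hjK : j + 1 ≤ C.K) (h : InnerRunOK C j s₁ R' ℓ₀ nA ca cb q')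
    (hlo₂ : 5 * (C.r : ℤ) + 10 * C.s * j + 2 + s₁ + 2 * R' ≤ ca) (htr₂ : |cb| + q' + 2 * s₁ + ((nA : ℤ) + 3) * R' ≤ 5 * (C.r : ℤ) - 2)
    (hφo : Φ.φ o ∈ Finset.Icc (C.faceLo x du j - (Rlev : Site 2)) (C.faceHi x du j + (Rlev : Site 2)))
    (hLA : 28 * C.r + 2 * Rlev ≤ L_A) :
    ∀ k ≤ nA, ((innerWAD Φ C x du o L_A L'_A ca cb q' s₁ R' ℓ₀ nA RlevA N j₀ j₁ Sfin).coreT Φ k).Nonempty := by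
  intro k hk
  obtain ⟨z, hz⟩ := Adv.core_nonempty (sgOf_sign du) (innerCtr C x du ca cb) (innerRun_advOK h) (k + 1)
  have hzR := Adv.core_succ_subset_regionR (sgOf_sign du) (innerCtr C x du ca cb) (innerRun_advOK h) hk hz
  have hzF := PCells.innerRun_regionR_subset_farAS C h hlo₂ htr₂ hk hzR
  rw [PCells.farAS, PCells.mem_psBox_iff] at hzF
  obtain ⟨ho1, ho2, ho3⟩ := lev_of_mem_faceRow_thicken C x du j Rlev hφo
  unfold PCells.lev at ho1 ho2
  have hsg : sgOf du = 1 ∨ sgOf du = -1 := sgOf_sign du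
  have hs1 := C.hs
  have hfL : 5 * (C.r : ℤ) ≤ C.faceL j ∧ C.faceL j ≤ 15 * (C.r : ℤ) := by
    have hsj : (C.s : ℤ) * (j + 1) ≤ C.r := by
      have h := Nat.mul_le_mul_left C.s hjK
      rw [Nat.mul_comm C.s C.K] at h
      exact_mod_cast (show C.s * (j + 1) ≤ C.r from h)
    have hs1' : (1 : ℤ) ≤ C.s := by exact_mod_cast hs1
    constructor <;> · unfold PCells.faceL; push_cast; nlinarith [Nat.zero_le j]
  obtain ⟨v, hv, hφv⟩ := Φ.toPlanarSkeleton.exists_mem_graphBall_φ_eq Φ.step o z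
  refine WinAdvData.coreT_nonempty_of Φ (graphBall_mono G o ?_ hv) (show Φ.φ v ∈ Adv.core _ _ _ _ _ _ _ (k + 1) by rw [hφv]; exact hz)
  show _ ≤ L_A
  have key := l1_le_of_ax du.1 (z - Φ.φ o) (m := 20 * C.r + Rlev) (n := 7 * C.r + Rlev) ?_ ?_
  · simp only [Pi.sub_apply] at key; omega
  · simp only [Pi.sub_apply]
    have := hzF.1.1; have := hzF.1.2
    rcases hsg with h1 | h1 <;> simp only [h1, one_mul, neg_mul] at ho1 ho2 hzF <;> constructor <;> nlinarith [hzF.1.1, hzF.1.2]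
  · simp only [Pi.sub_apply]
    have := hzF.2.1; have := hzF.2.2; have := (abs_le.1 ho3).1; have := (abs_le.1 ho3).2
    constructor <;> linarith

/-! ## §2 The route clause at a deep contact of the face window -/

/-- **The route clause of `SkelI.hcon_win₂'` for the face window at a deep contact** (see the module docstring).
[cite: KozmaNitzan2024, §4 Lemma 11 (pp. 22–23), Lemma 12 (p. 24)] -/
theorem hroute_face [Countable V] {C : PCells} {x : Site 2} {du : MDir} {j : ℕ} (hjK : j + 1 ≤ C.K)
    {p : unitInterval} (hC : Φ.toPlanarSkeleton.CylSubcritical p)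
    -- the inner-run constants
    {s₁ R' ℓ₀ ℓ1 Rlev M nmax RlevA N L_A L'_A : ℕ} (hMℓ : M < ℓ₀) (hs : R' + ℓ₀ ≤ s₁) (hs2 : 2 * R' ≤ s₁) (hℓ1 : M + s₁ + 2 * R' + 1 ≤ ℓ1)
    (hn : 12 * C.r ≤ nmax * s₁) (hbig : Rlev + ℓ1 + 2 * s₁ + (nmax + 3) * R' ≤ C.r) (h10s : Rlev + ℓ1 + 3 ≤ 10 * C.s)
    (hRl : RlevA + 1 ≤ R') (hℓL : fatRadius Φ hC ℓ1 ≤ L_A) (hLA : 28 * C.r + 2 * Rlev ≤ L_A)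
    {τ : ℤˣ} (hτ : (τ : ℤ) = sgOf du)
    -- the face window and its law
    {w₀ : V} {R R₁' : ℕ} {Λ : ConcRadiiG} {a' : ℕ} (hR₁R : R₁' ≤ R) (hR₁M : R₁' + 1 ≤ Λ.rM a' (x + stepVec du))
    {Wt : Sym2 V → unitInterval} {q : unitInterval} (hWD : IsSubbox (winGraph G w₀ R) Wt q (Φ.Win w₀ (C.farAS x du j) R))
    (hWG : ∀ e, e ∉ G.edgeSet → Wt e = 0) {Sfin : Finset V} (hRgS : Φ.Win w₀ (C.farAS x du j) R ⊆ Sfin)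
    -- the contact's cube centre: footprint in the thickened face row, deep
    {o : V} (hφo : Φ.φ o ∈ Finset.Icc (C.faceLo x du j - (Rlev : Site 2)) (C.faceHi x du j + (Rlev : Site 2)))
    (hdeep : graphBall G o L_A ⊆ graphBall G w₀ R₁') {mₛ : ℕ} (hmM : mₛ ≤ M)
    -- the chain estimate, the count, the inner kits under the route law, the excess radius
    {Δ' : ℕ} {δ ε'' η : ℝ}
    (hchain : ∀ n ≤ nmax, ∀ (Wg : Sym2 V → unitInterval) (s : Fin (n + 1) → TStep (winGraph G o L_A)) (T' : Fin (n + 1) → Finset V) (η : ℝ),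
      (∀ i, (s i).L.o = (s 0).L.o) →
      (∀ i : Fin n, T' (Fin.castSucc i) ⊆ (s i.succ).L.X 0) →
      (∀ i, T' i ⊆ (s i).T) →
      (∀ i, (s i).KitsAt Wg q Δ' δ) →
      η ≤ δ / 2 →
      (∀ i, (prodBernoulli Wg).real (⋃ t ∈ (s i).T \ T' i, openConn (s 0).L.o t) ≤ η) →
      1 - δ < (prodBernoulli Wg).real (s 0).L.reachB →
        1 - ε'' < (prodBernoulli Wg).real (⋃ t ∈ T' (Fin.last n), openConn (s 0).L.o t))
    (hcount : 1 / (1 - (q : ℝ)) ^ (Δ' * N) ≤ δ * ((Finset.Icc (M + 1) RlevA).card : ℝ))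
    (hkitsA : ∀ (o : V) (mₛ : ℕ) (ca cb : ℤ) (nA : ℕ), mₛ ≤ M → nA ≤ nmax → InnerRunOK C j s₁ R' ℓ₀ nA ca cb ℓ1 → ∀ k ≤ nA, ∀ j' ∈ Finset.Icc (M + 1) RlevA, ∃ (σ : SData V) (Sz : Finset V),
      SHyp (winLData Φ o L_A ((innerWAD Φ C x du o L_A L'_A ca cb ℓ1 s₁ R' ℓ₀ nA RlevA N (M + 1) RlevA Sfin).alo k)
        ((innerWAD Φ C x du o L_A L'_A ca cb ℓ1 s₁ R' ℓ₀ nA RlevA N (M + 1) RlevA Sfin).ahi k) o Sfin) j' σ ∧ σ.N ≤ N ∧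
      (1 - (q : ℝ) ^ σ.sB) ^ σ.k ≤ δ ∧
      Sz ⊆ (winLData Φ o L_A ((innerWAD Φ C x du o L_A L'_A ca cb ℓ1 s₁ R' ℓ₀ nA RlevA N (M + 1) RlevA Sfin).alo k)
        ((innerWAD Φ C x du o L_A L'_A ca cb ℓ1 s₁ R' ℓ₀ nA RlevA N (M + 1) RlevA Sfin).ahi k) o Sfin).X j' ∧
      Sz ⊆ (innerWAD Φ C x du o L_A L'_A ca cb ℓ1 s₁ R' ℓ₀ nA RlevA N (M + 1) RlevA Sfin).stepDR Φ k ∧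
      (∀ y ∈ σ.K, ∀ e ∈ σ.seed y, e ∉ wireSet (↑Sz : Set V)) ∧ (∀ y ∈ σ.K, σ.face y ⊆ Sz) ∧
      (∀ y ∈ σ.K, 1 - 3 * δ ≤ (prodBernoulli (routeW G Wt (innerQt Φ C x du o L_A s₁ R' nA ca cb ℓ1 (Φ.φ o) ℓ1) (fatSeq Φ hC o mₛ))).real {ω | ∃ u ∈ σ.face y,
        1 - δ < (prodBernoulli (pinW (routeW G Wt (innerQt Φ C x du o L_A s₁ R' nA ca cb ℓ1 (Φ.φ o) ℓ1) (fatSeq Φ hC o mₛ)) (wireSet (↑Sz : Set V)) ω)).real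
          (⋃ z ∈ (innerWAD Φ C x du o L_A L'_A ca cb ℓ1 s₁ R' ℓ₀ nA RlevA N (M + 1) RlevA Sfin).coreE Φ k,
            openConnIn (↑((innerWAD Φ C x du o L_A L'_A ca cb ℓ1 s₁ R' ℓ₀ nA RlevA N (M + 1) RlevA Sfin).stepDR Φ k) : Set V) u z)}))
    (hη : η ≤ δ / 2) {R₁ : ℕ}
    (hR₁ : ∀ (c' : V) (R'' : ℕ), R₁ ≤ R'' → ∀ (Rw : ℕ) (D' A' : Finset V), (∀ d ∈ D', d ∈ graphBall G c' Rw) →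
      (∀ d ∈ D', ∀ d' ∈ D', Φ.φ d - Φ.φ d' ∈ box 2 (50 * C.r)) → A' ⊆ D' → (∀ a ∈ A', a ∈ graphBall G c' (2 * fatRadius Φ hC M)) →
        (bondPercolation G q).real (excess G c' R'' D' A') ≤ η)
    (hR : R₁ ≤ L_A - L'_A)
    -- the fine first-hop link input
    (hlink : 1 - δ < (bondPercolation G q).real
      (linkIn (↑(fatSeq Φ hC o ℓ1)) (fatSeq Φ hC o mₛ) (macroPiece Φ o ℓ1 (fatRadius Φ hC ℓ1) (faceElt du.1 τ)))) :
    ∃ Qt Ft : Finset V, Ft ⊆ (cellGeomSG Φ C w₀ Λ).M a' (x + stepVec du) ∧ Qt ⊆ Φ.Win w₀ (C.farAS x du j) R ∧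
      (∀ u ∈ Qt, ∀ v ∈ Qt, G.Adj u v → (winGraph G w₀ R).Adj u v) ∧ Disjoint Ft (fatSeq Φ hC o M) ∧
      1 - ε'' < (prodBernoulli Wt).real (linkIn (↑Qt : Set V) (fatSeq Φ hC o mₛ) Ft) := by
  -- the inner run through the contact's cube centre
  obtain ⟨ho1, ho2, hob⟩ := lev_of_mem_faceRow_thicken C x du j Rlev hφo
  have hlv1 : 5 * (C.r : ℤ) + 10 * C.s * (j + 1 : ℕ) - 1 - Rlev ≤ C.lev du x (Φ.φ o) := by unfold PCells.faceL at ho1; push_cast at ho1 ⊢; linarith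
  have hlv2 : C.lev du x (Φ.φ o) ≤ 5 * (C.r : ℤ) + 10 * C.s * (j + 1 : ℕ) - 1 + Rlev := by unfold PCells.faceL at ho2; push_cast at ho2 ⊢; linarith
  obtain ⟨hOK, hnA, ⟨hlo₂, htr₂⟩, ⟨h1, h2, h3, h4⟩, hsepM⟩ :=
    PCells.innerRunOK_contact_shifted C hjK hMℓ hs hs2 hℓ1 hn hbig h10s hlv1 hlv2 hob
  have hballR : graphBall G o L_A ⊆ graphBall G w₀ R := hdeep.trans (graphBall_mono G w₀ hR₁R)
  have h3' : C.cen x (oth du.1) - (5 * (C.r : ℤ) - 2) ≤ Φ.φ o (oth du.1) - ℓ1 := by linarith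
  have h4' : Φ.φ o (oth du.1) + ℓ1 ≤ C.cen x (oth du.1) + (5 * (C.r : ℤ) - 2) := by linarith
  have hQ : innerQt Φ C x du o L_A s₁ R' ((17 * (C.r : ℤ) - (C.lev du x (Φ.φ o) + ℓ1)).toNat / s₁) (C.lev du x (Φ.φ o) + ℓ1) (Φ.φ o (oth du.1) - C.cen x (oth du.1)) ℓ1 (Φ.φ o) ℓ1 ⊆ Φ.Win w₀ (C.farAS x du j) R :=
    innerQt_subset_Win_farAS Φ hballR hOK hlo₂ htr₂ h1 h2 h3' h4'
  have hQfar : innerQtPl C x du s₁ R' ((17 * (C.r : ℤ) - (C.lev du x (Φ.φ o) + ℓ1)).toNat / s₁) (C.lev du x (Φ.φ o) + ℓ1) (Φ.φ o (oth du.1) - C.cen x (oth du.1)) ℓ1 (Φ.φ o) ℓ1 ⊆ C.farAS x du j :=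
    innerQtPl_subset_farAS hOK hlo₂ htr₂ h1 h2 h3' h4'
  have hsep : C.lev du x (Φ.φ o) + mₛ < (C.lev du x (Φ.φ o) + ℓ1) - (s₁ + 2 * R') := by
    have : (mₛ : ℤ) ≤ M := by exact_mod_cast hmM
    linarith
  -- the cubes about `o` (scales `≤ ℓ1`) miss the far cell's inner square: their levels are `< 17 r`
  have hSm : ∀ m ≤ ℓ1, ∀ z ∈ fatSeq Φ hC o m, Φ.φ z ∉ C.M (x + stepVec du) := by
    intro m hm z hz hzM
    have h17 := PCells.lev_ge_of_mem_M_add C hzM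
    have hbox := fatSeq_sub_mem_box Φ hC o m z hz
    rw [mem_box] at hbox
    have hzl := hbox du.1
    rw [Pi.sub_apply] at hzl
    have e1 : -(m : ℤ) ≤ Φ.φ z du.1 - Φ.φ o du.1 ∧ Φ.φ z du.1 - Φ.φ o du.1 ≤ m := by
      omega
    have hsj : (C.s : ℤ) * (j + 1) ≤ C.r := by
      have h := Nat.mul_le_mul_left C.s hjK
      rw [Nat.mul_comm C.s C.K] at h
      exact_mod_cast (show C.s * (j + 1) ≤ C.r from h)
    unfold PCells.lev at h17 hlv2
    have hbig' : (Rlev : ℤ) + ℓ1 ≤ C.r := by exact_mod_cast (show Rlev + ℓ1 ≤ C.r by omega)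
    have hm' : (m : ℤ) ≤ ℓ1 := by exact_mod_cast hm
    push_cast at hlv2
    rcases sgOf_sign du with hsg | hsg <;> rw [hsg] at h17 hlv2 <;> simp only [one_mul, neg_mul] at h17 hlv2 <;> linarith [e1.1, e1.2]
  refine ⟨innerQt Φ C x du o L_A s₁ R' ((17 * (C.r : ℤ) - (C.lev du x (Φ.φ o) + ℓ1)).toNat / s₁) (C.lev du x (Φ.φ o) + ℓ1) (Φ.φ o (oth du.1) - C.cen x (oth du.1)) ℓ1 (Φ.φ o) ℓ1,
    (innerWAD Φ C x du o L_A L'_A (C.lev du x (Φ.φ o) + ℓ1) (Φ.φ o (oth du.1) - C.cen x (oth du.1)) ℓ1 s₁ R' ℓ₀ ((17 * (C.r : ℤ) - (C.lev du x (Φ.φ o) + ℓ1)).toNat / s₁) RlevA N (M + 1) RlevA Sfin).coreT Φ ((17 * (C.r : ℤ) - (C.lev du x (Φ.φ o) + ℓ1)).toNat / s₁),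
    innerWAD_coreT_subset_M Φ hdeep hR₁M hOK, hQ,
    fun u hu v hv huv => (winGraph_adj G).2 ⟨huv, (Φ.mem_Win.1 (hQ hu)).1, (Φ.mem_Win.1 (hQ hv)).1⟩,
    innerWAD_coreT_disjoint Φ hOK (hSm M (by omega)), ?_⟩
  exact innerRoute_link_lt Φ hOK hRl le_rfl (innerWAD_coreT_nonempty Φ hjK hOK hlo₂ htr₂ hφo hLA) hC (hmM.trans (by omega)) hℓL hτ
    rfl rfl rfl hsep (hSm mₛ (by omega)) hWD (fun u hu => (Φ.mem_Win.1 hu).1) hWG hQ (hQ.trans hRgS) hQfar (hchain ((17 * (C.r : ℤ) - (C.lev du x (Φ.φ o) + ℓ1)).toNat / s₁) hnA) hcount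
    (hkitsA o mₛ (C.lev du x (Φ.φ o) + ℓ1) (Φ.φ o (oth du.1) - C.cen x (oth du.1)) ((17 * (C.r : ℤ) - (C.lev du x (Φ.φ o) + ℓ1)).toNat / s₁) hmM hnA hOK) hη
    (fun c' R'' hR'' Rw D' A' hD hDD hA hA' => hR₁ c' R'' hR'' Rw D' A' hD hDD hA fun a ha =>
      graphBall_mono G c' (Nat.mul_le_mul_left 2 (fatRadius_mono Φ hC hmM)) (hA' a ha))
    hR hlink

/-! ## §3 The route clause with a free inner level window -/

/-- **The route clause at a deep contact, free inner level window `[j₀A, RlevA]`** (the deep seed slab of the inner kits needs levels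
`≥ T₀`; `hroute_face` is the instance `j₀A = M + 1`). Same proof.
[cite: KozmaNitzan2024, §4 Lemma 11 (pp. 22–23), Lemma 12 (p. 24)] -/
theorem hroute_face' [Countable V] {C : PCells} {x : Site 2} {du : MDir} {j : ℕ} (hjK : j + 1 ≤ C.K)
    {p : unitInterval} (hC : Φ.toPlanarSkeleton.CylSubcritical p)
    -- the inner-run constants
    {s₁ R' ℓ₀ ℓ1 Rlev M nmax j₀A RlevA N L_A L'_A : ℕ} (hMℓ : M < ℓ₀) (hs : R' + ℓ₀ ≤ s₁) (hs2 : 2 * R' ≤ s₁) (hℓ1 : M + s₁ + 2 * R' + 1 ≤ ℓ1)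
    (hn : 12 * C.r ≤ nmax * s₁) (hbig : Rlev + ℓ1 + 2 * s₁ + (nmax + 3) * R' ≤ C.r) (h10s : Rlev + ℓ1 + 3 ≤ 10 * C.s)
    (hRl : RlevA + 1 ≤ R') (hℓL : fatRadius Φ hC ℓ1 ≤ L_A) (hLA : 28 * C.r + 2 * Rlev ≤ L_A)
    {τ : ℤˣ} (hτ : (τ : ℤ) = sgOf du)
    -- the face window and its law
    {w₀ : V} {R R₁' : ℕ} {Λ : ConcRadiiG} {a' : ℕ} (hR₁R : R₁' ≤ R) (hR₁M : R₁' + 1 ≤ Λ.rM a' (x + stepVec du))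
    {Wt : Sym2 V → unitInterval} {q : unitInterval} (hWD : IsSubbox (winGraph G w₀ R) Wt q (Φ.Win w₀ (C.farAS x du j) R))
    (hWG : ∀ e, e ∉ G.edgeSet → Wt e = 0) {Sfin : Finset V} (hRgS : Φ.Win w₀ (C.farAS x du j) R ⊆ Sfin)
    -- the contact's cube centre: footprint in the thickened face row, deep
    {o : V} (hφo : Φ.φ o ∈ Finset.Icc (C.faceLo x du j - (Rlev : Site 2)) (C.faceHi x du j + (Rlev : Site 2)))
    (hdeep : graphBall G o L_A ⊆ graphBall G w₀ R₁') {mₛ : ℕ} (hmM : mₛ ≤ M)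
    -- the chain estimate, the count, the inner kits under the route law, the excess radius
    {Δ' : ℕ} {δ ε'' η : ℝ}
    (hchain : ∀ n ≤ nmax, ∀ (Wg : Sym2 V → unitInterval) (s : Fin (n + 1) → TStep (winGraph G o L_A)) (T' : Fin (n + 1) → Finset V) (η : ℝ),
      (∀ i, (s i).L.o = (s 0).L.o) →
      (∀ i : Fin n, T' (Fin.castSucc i) ⊆ (s i.succ).L.X 0) →
      (∀ i, T' i ⊆ (s i).T) →
      (∀ i, (s i).KitsAt Wg q Δ' δ) →
      η ≤ δ / 2 →
      (∀ i, (prodBernoulli Wg).real (⋃ t ∈ (s i).T \ T' i, openConn (s 0).L.o t) ≤ η) →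
      1 - δ < (prodBernoulli Wg).real (s 0).L.reachB →
        1 - ε'' < (prodBernoulli Wg).real (⋃ t ∈ T' (Fin.last n), openConn (s 0).L.o t))
    (hcount : 1 / (1 - (q : ℝ)) ^ (Δ' * N) ≤ δ * ((Finset.Icc j₀A RlevA).card : ℝ))
    (hkitsA : ∀ (o : V) (mₛ : ℕ) (ca cb : ℤ) (nA : ℕ), mₛ ≤ M → nA ≤ nmax → InnerRunOK C j s₁ R' ℓ₀ nA ca cb ℓ1 → ∀ k ≤ nA, ∀ j' ∈ Finset.Icc j₀A RlevA, ∃ (σ : SData V) (Sz : Finset V),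
      SHyp (winLData Φ o L_A ((innerWAD Φ C x du o L_A L'_A ca cb ℓ1 s₁ R' ℓ₀ nA RlevA N j₀A RlevA Sfin).alo k)
        ((innerWAD Φ C x du o L_A L'_A ca cb ℓ1 s₁ R' ℓ₀ nA RlevA N j₀A RlevA Sfin).ahi k) o Sfin) j' σ ∧ σ.N ≤ N ∧
      (1 - (q : ℝ) ^ σ.sB) ^ σ.k ≤ δ ∧
      Sz ⊆ (winLData Φ o L_A ((innerWAD Φ C x du o L_A L'_A ca cb ℓ1 s₁ R' ℓ₀ nA RlevA N j₀A RlevA Sfin).alo k)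
        ((innerWAD Φ C x du o L_A L'_A ca cb ℓ1 s₁ R' ℓ₀ nA RlevA N j₀A RlevA Sfin).ahi k) o Sfin).X j' ∧
      Sz ⊆ (innerWAD Φ C x du o L_A L'_A ca cb ℓ1 s₁ R' ℓ₀ nA RlevA N j₀A RlevA Sfin).stepDR Φ k ∧
      (∀ y ∈ σ.K, ∀ e ∈ σ.seed y, e ∉ wireSet (↑Sz : Set V)) ∧ (∀ y ∈ σ.K, σ.face y ⊆ Sz) ∧
      (∀ y ∈ σ.K, 1 - 3 * δ ≤ (prodBernoulli (routeW G Wt (innerQt Φ C x du o L_A s₁ R' nA ca cb ℓ1 (Φ.φ o) ℓ1) (fatSeq Φ hC o mₛ))).real {ω | ∃ u ∈ σ.face y,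
        1 - δ < (prodBernoulli (pinW (routeW G Wt (innerQt Φ C x du o L_A s₁ R' nA ca cb ℓ1 (Φ.φ o) ℓ1) (fatSeq Φ hC o mₛ)) (wireSet (↑Sz : Set V)) ω)).real
          (⋃ z ∈ (innerWAD Φ C x du o L_A L'_A ca cb ℓ1 s₁ R' ℓ₀ nA RlevA N j₀A RlevA Sfin).coreE Φ k,
            openConnIn (↑((innerWAD Φ C x du o L_A L'_A ca cb ℓ1 s₁ R' ℓ₀ nA RlevA N j₀A RlevA Sfin).stepDR Φ k) : Set V) u z)}))
    (hη : η ≤ δ / 2) {R₁ : ℕ}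
    (hR₁ : ∀ (c' : V) (R'' : ℕ), R₁ ≤ R'' → ∀ (Rw : ℕ) (D' A' : Finset V), (∀ d ∈ D', d ∈ graphBall G c' Rw) →
      (∀ d ∈ D', ∀ d' ∈ D', Φ.φ d - Φ.φ d' ∈ box 2 (50 * C.r)) → A' ⊆ D' → (∀ a ∈ A', a ∈ graphBall G c' (2 * fatRadius Φ hC M)) →
        (bondPercolation G q).real (excess G c' R'' D' A') ≤ η)
    (hR : R₁ ≤ L_A - L'_A)
    -- the fine first-hop link input
    (hlink : 1 - δ < (bondPercolation G q).real
      (linkIn (↑(fatSeq Φ hC o ℓ1)) (fatSeq Φ hC o mₛ) (macroPiece Φ o ℓ1 (fatRadius Φ hC ℓ1) (faceElt du.1 τ)))) :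
    ∃ Qt Ft : Finset V, Ft ⊆ (cellGeomSG Φ C w₀ Λ).M a' (x + stepVec du) ∧ Qt ⊆ Φ.Win w₀ (C.farAS x du j) R ∧
      (∀ u ∈ Qt, ∀ v ∈ Qt, G.Adj u v → (winGraph G w₀ R).Adj u v) ∧ Disjoint Ft (fatSeq Φ hC o M) ∧
      1 - ε'' < (prodBernoulli Wt).real (linkIn (↑Qt : Set V) (fatSeq Φ hC o mₛ) Ft) := by
  -- the inner run through the contact's cube centre
  obtain ⟨ho1, ho2, hob⟩ := lev_of_mem_faceRow_thicken C x du j Rlev hφo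
  have hlv1 : 5 * (C.r : ℤ) + 10 * C.s * (j + 1 : ℕ) - 1 - Rlev ≤ C.lev du x (Φ.φ o) := by unfold PCells.faceL at ho1; push_cast at ho1 ⊢; linarith
  have hlv2 : C.lev du x (Φ.φ o) ≤ 5 * (C.r : ℤ) + 10 * C.s * (j + 1 : ℕ) - 1 + Rlev := by unfold PCells.faceL at ho2; push_cast at ho2 ⊢; linarith
  obtain ⟨hOK, hnA, ⟨hlo₂, htr₂⟩, ⟨h1, h2, h3, h4⟩, hsepM⟩ :=
    PCells.innerRunOK_contact_shifted C hjK hMℓ hs hs2 hℓ1 hn hbig h10s hlv1 hlv2 hob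
  have hballR : graphBall G o L_A ⊆ graphBall G w₀ R := hdeep.trans (graphBall_mono G w₀ hR₁R)
  have h3' : C.cen x (oth du.1) - (5 * (C.r : ℤ) - 2) ≤ Φ.φ o (oth du.1) - ℓ1 := by linarith
  have h4' : Φ.φ o (oth du.1) + ℓ1 ≤ C.cen x (oth du.1) + (5 * (C.r : ℤ) - 2) := by linarith
  have hQ : innerQt Φ C x du o L_A s₁ R' ((17 * (C.r : ℤ) - (C.lev du x (Φ.φ o) + ℓ1)).toNat / s₁) (C.lev du x (Φ.φ o) + ℓ1) (Φ.φ o (oth du.1) - C.cen x (oth du.1)) ℓ1 (Φ.φ o) ℓ1 ⊆ Φ.Win w₀ (C.farAS x du j) R :=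
    innerQt_subset_Win_farAS Φ hballR hOK hlo₂ htr₂ h1 h2 h3' h4'
  have hQfar : innerQtPl C x du s₁ R' ((17 * (C.r : ℤ) - (C.lev du x (Φ.φ o) + ℓ1)).toNat / s₁) (C.lev du x (Φ.φ o) + ℓ1) (Φ.φ o (oth du.1) - C.cen x (oth du.1)) ℓ1 (Φ.φ o) ℓ1 ⊆ C.farAS x du j :=
    innerQtPl_subset_farAS hOK hlo₂ htr₂ h1 h2 h3' h4'
  have hsep : C.lev du x (Φ.φ o) + mₛ < (C.lev du x (Φ.φ o) + ℓ1) - (s₁ + 2 * R') := by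
    have : (mₛ : ℤ) ≤ M := by exact_mod_cast hmM
    linarith
  -- the cubes about `o` (scales `≤ ℓ1`) miss the far cell's inner square: their levels are `< 17 r`
  have hSm : ∀ m ≤ ℓ1, ∀ z ∈ fatSeq Φ hC o m, Φ.φ z ∉ C.M (x + stepVec du) := by
    intro m hm z hz hzM
    have h17 := PCells.lev_ge_of_mem_M_add C hzM
    have hbox := fatSeq_sub_mem_box Φ hC o m z hz
    rw [mem_box] at hbox
    have hzl := hbox du.1
    rw [Pi.sub_apply] at hzl
    have e1 : -(m : ℤ) ≤ Φ.φ z du.1 - Φ.φ o du.1 ∧ Φ.φ z du.1 - Φ.φ o du.1 ≤ m := by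
      omega
    have hsj : (C.s : ℤ) * (j + 1) ≤ C.r := by
      have h := Nat.mul_le_mul_left C.s hjK
      rw [Nat.mul_comm C.s C.K] at h
      exact_mod_cast (show C.s * (j + 1) ≤ C.r from h)
    unfold PCells.lev at h17 hlv2
    have hbig' : (Rlev : ℤ) + ℓ1 ≤ C.r := by exact_mod_cast (show Rlev + ℓ1 ≤ C.r by omega)
    have hm' : (m : ℤ) ≤ ℓ1 := by exact_mod_cast hm
    push_cast at hlv2
    rcases sgOf_sign du with hsg | hsg <;> rw [hsg] at h17 hlv2 <;> simp only [one_mul, neg_mul] at h17 hlv2 <;> linarith [e1.1, e1.2]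
  refine ⟨innerQt Φ C x du o L_A s₁ R' ((17 * (C.r : ℤ) - (C.lev du x (Φ.φ o) + ℓ1)).toNat / s₁) (C.lev du x (Φ.φ o) + ℓ1) (Φ.φ o (oth du.1) - C.cen x (oth du.1)) ℓ1 (Φ.φ o) ℓ1,
    (innerWAD Φ C x du o L_A L'_A (C.lev du x (Φ.φ o) + ℓ1) (Φ.φ o (oth du.1) - C.cen x (oth du.1)) ℓ1 s₁ R' ℓ₀ ((17 * (C.r : ℤ) - (C.lev du x (Φ.φ o) + ℓ1)).toNat / s₁) RlevA N j₀A RlevA Sfin).coreT Φ ((17 * (C.r : ℤ) - (C.lev du x (Φ.φ o) + ℓ1)).toNat / s₁),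
    innerWAD_coreT_subset_M Φ hdeep hR₁M hOK, hQ,
    fun u hu v hv huv => (winGraph_adj G).2 ⟨huv, (Φ.mem_Win.1 (hQ hu)).1, (Φ.mem_Win.1 (hQ hv)).1⟩,
    innerWAD_coreT_disjoint Φ hOK (hSm M (by omega)), ?_⟩
  exact innerRoute_link_lt Φ hOK hRl le_rfl (innerWAD_coreT_nonempty Φ hjK hOK hlo₂ htr₂ hφo hLA) hC (hmM.trans (by omega)) hℓL hτ
    rfl rfl rfl hsep (hSm mₛ (by omega)) hWD (fun u hu => (Φ.mem_Win.1 hu).1) hWG hQ (hQ.trans hRgS) hQfar (hchain ((17 * (C.r : ℤ) - (C.lev du x (Φ.φ o) + ℓ1)).toNat / s₁) hnA) hcount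
    (hkitsA o mₛ (C.lev du x (Φ.φ o) + ℓ1) (Φ.φ o (oth du.1) - C.cen x (oth du.1)) ((17 * (C.r : ℤ) - (C.lev du x (Φ.φ o) + ℓ1)).toNat / s₁) hmM hnA hOK) hη
    (fun c' R'' hR'' Rw D' A' hD hDD hA hA' => hR₁ c' R'' hR'' Rw D' A' hD hDD hA fun a ha =>
      graphBall_mono G c' (Nat.mul_le_mul_left 2 (fatRadius_mono Φ hC hmM)) (hA' a ha))
    hR hlink

end Skel

end Transplant

end Summit.CriticalPhenomena.PercolationContinuityZ3.Theorems

end
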